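import Summits.Ventures.QEC.Census.CertCoverBatch
import Summits.Ventures.QEC.Census.BB.A1s_n168_k6_b088e501.CoreDefs
import HarnessLib

set_option Elab.async false
set_option maxRecDepth 200000

/-!
# `[[168,6,16]]` one-level cover certificate of `A1s_n168_k6_b088e501` — LEVEL-1→0 coset problems 298…324 (deep problems [14] excluded: `ProbDeep*.lean`) as COMPACT data
(`ProbData`: U, f, σ, y₀, allow; qec-type-10 `CertCoverBatch.mkCoset` rebuilds each `CosetProb` in the kernel) + their verdict
`probsOK cov covR hx hx1 D1 lxd 14` (one `decide +kernel`; 27 problems, depths f=0:25 f=1:2 f=2:0 f=3:0, est. 103.5 s).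
qec-search-1 g5 (pattern of search-9 g5 `Probs*`); data from JSON `level10.problems` (sha256 2bd67f9f8666097b…). Data + decided check; KERNEL.
-/

namespace Summit.Ventures.QEC.Census.A1s_n168_k6_b088e501

open Matrix Summit.Ventures.QEC.Census Literature.InformationTheory.QuantumCodes

/-- Problems 298…324 (27): `⟨U, f, σ, y₀, allow⟩`. -/
def probs06b : List ProbData := [
    ⟨38978060372721182706209, 0, 141742318098, 37779003923025574889504, []⟩,
    ⟨38978277317296840015912, 0, 1322884006530, 37797379451799398776840, [0]⟩,
    ⟨38978312794203446312969, 0, 2353675642006, 1199380647297612382241, []⟩,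
    ⟨38996994578611156549745, 0, 1271377440528, 1218061569963292313799, []⟩,
    ⟨39033456976495714018352, 0, 214765668096, 1180591770255287682048, [0]⟩,
    ⟨39033601228023768590336, 1, 223372378624, 37852721376924836833312, [32, 274877906944, 8796093022208]⟩,
    ⟨39034464512614322044964, 0, 421043634240, 38960677531096804098709, []⟩,
    ⟨39034466807552250249376, 1, 137573702656, 37852722221349766955040, [0]⟩,
    ⟨39034753899401832339456, 0, 421142204416, 1443403697752117376, []⟩,
    ⟨39034755310608359393408, 0, 154787125760, 1182032807783615725728, []⟩,
    ⟨39035652971906159616256, 0, 3298534896132, 38959523560777834569769, []⟩,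
    ⟨39070787168670933066320, 0, 206225549056, 37890188788154820790850, []⟩,
    ⟨39107678981989395894273, 0, 240585828368, 37778932426181993041921, [0]⟩,
    ⟨39108256023277396336833, 0, 137573727248, 1329323034145449869504, [0]⟩,
    ⟨39109410105879167009088, 0, 68720030720, 37781237776618587422976, [0]⟩,
    ⟨39255834506404735000578, 0, 137573735457, 37778932989131946467330, [0]⟩,
    ⟨39550991367106296062340, 0, 137573768258, 37778932989131946467332, [0]⟩,
    ⟨41544378018482708611073, 0, 343732676624, 1330475919920232136704, [0]⟩,
    ⟨76813415618390232563780, 0, 136852546, 75559034769578169237569, []⟩,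
    ⟨76909314043995244988432, 0, 206183613697, 1180591629517799327265, []⟩,
    ⟨76923212715459726147632, 0, 1237053359872, 76738455918379874045441, []⟩,
    ⟨77478636586508922945572, 0, 489626878016, 77478635460609982092817, []⟩,
    ⟨79693395503249591828736, 0, 412320086016, 3544080793122378023168, [0]⟩,
    ⟨79838665802516051198016, 0, 274881136640, 3541774879753010085888, [0]⟩,
    ⟨81626924725658353928212, 0, 755914261825, 76738455346632721352295, []⟩,
    ⟨114666404011774071422992, 0, 1236986512640, 114664961733994829237412, []⟩,
    ⟨157614750653918451073539, 0, 687194837040, 5907569965527344349699, [0]⟩]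

set_option maxHeartbeats 400000000 in
/-- Every problem of this chunk passes (`mkCoset` elimination + `cosetOKD` + fast `σ` + depth + `BU`-evenness + label checks). -/
theorem probs06b_ok : probsOK A1s_n168_k6_b088e501.cov covR hx hx1 D1 lxd 14 probs06b = true := by
  decide +kernel

/-- Pointwise form. -/
theorem probs06b_all : ∀ x ∈ probs06b, probOK A1s_n168_k6_b088e501.cov covR hx hx1 D1 lxd 14 x = true := by
  have h := probs06b_ok
  rwa [probsOK, List.all_eq_true] at h

end Summit.Ventures.QEC.Census.A1s_n168_k6_b088e501
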